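import Literature.MathematicalPhysics.QuantumFieldTheory.Balaban1983to89.B9Ineq363Vprime

/-!
# `Balaban1983to89.B9Eq370LetterConversion` — B9 p. 403 l.1–9 with (3.70), (3.74), (3.53): THE THREE LETTER CONVERSIONS
# `∇_U ↦ ∇_{U′U}` (left), `∇*_U ↦ ∇*_{U′U}` (right), `Δ_U ↦ Δ_{U′U}` (Laplacian) OF THE (3.42) BLOCK AT THE BLOCK-MAJORANT LEVEL,
# in r06's letter calculus ([4] (2.51)–(2.55)), every `O(1)` explicit; kernel-checked; v1

T. Bałaban, *Propagators for lattice gauge theories in a background field*, Commun. Math. Phys. **99** (1985) 389–434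
[`Balaban1985BackgroundPropagators`, "B9"]; T. Bałaban, *Propagators and renormalization transformations for lattice gauge
theories. II*, Commun. Math. Phys. **96** (1984) 223–250 [`Balaban1984PropagatorsII`, "[4]"].

statement-level skeleton of published theorems with citation tags; proofs where landed; nothing here is a claim about the
Yang–Mills mass gap

THE PRINTED LOCUS.  p. 403 l.1–9: *«Now applying Theorem 3.1 for G′(U), the bound (3.63), the representation (3.64) and Lemma 2.1
of [4] we can prove all the statements (3.42)–(3.47) of Theorem 3.1 for the operator G′(U′U), of course with different constants,
although changes are small.»*  The tree's reading of (3.42) AT the extended configuration `W = U′U` (`Node00.OpsYOfLetters.kernelFamilyS`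
at `cfg W`) takes the covariant differences `∇_W`, `∇*_W` and the Laplacian `Δ_W` of the entries AT `W`, whereas the Sect.-B frames
(`B9SectBGpStepAtLettersV2.GpFrame₂`, r06's `B9Thm34SectBUniformR1.thm34_Gp_uniform`) deliver the entries of `G′(U′U)` with the
letters AT THE BASE `U`.  The conversion is print's (3.70) p. 404 (`D_{U′U} = D_U + (R(U′) − 1)R(U)τ`), (3.74) p. 405 (the same for
`D*`) and (3.53) p. 400 (`Δ_{U′U} = Δ_U − V′₁(A)`), each composed with the (3.42) entries of `G′(U′U)` by [4] (2.52)–(2.55) and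
Lemma 2.1 — this file, for an ARBITRARY operator `Gp` with the two (3.42)-type majorants (so it serves `G′(U′U)`, the remainders
of (3.65), and any later letter alike).

WHAT THIS FILE PROVES (0 sorry, theorems only; r06's abstract carrier: sites `S`, directions `κ`, shifts `T`, background
`U : κ → S → 𝔸ˣ`, field `A : κ → S → 𝔸` with `U′ = e^{iηA}` (`B9Eq39Adjoint.prodCfg ∕ fluct`), geometry `g`, block map `blk`,
real basis `b` of `𝔸` with coordinate constant `M₂`):
* §1 `exp_sub_one_le_mul_exp`, `exp_two_mul_sub_one_le` (`e^{2s} − 1 ≦ 4s` for `0 ≦ s ≦ 1/4`) — the smallness arithmetic of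
  «R(U′) = exp ηiad_A = 1 + ⋯» (p. 405).
* §2 the TRANSPORT-DEFECT LETTERS `∇♯_{U′U,k} − ∇♯_{U,k}` (`k ∈ κ ⊕ κ`: forward `η⁻¹(D_{U′U,μ} − D_{U,μ})`, backward
  `−η⁻¹(D*_{U′U,μ} − D*_{U,μ})`) unfolded (`diffLetter_prodCfg_sub_apply_inl ∕ _inr`, from r06's `B9Eq370Expansion.covD_prodCfg ∕
  covDstar_prodCfg`), bounded pointwise by `4ρ²·α₁ℓ⁻¹·‖λ(neighbour)‖` under (3.37) read blockwise (`‖A_μ(x)‖, ‖τ*_μA_μ(x)‖ ≦ α₁ℓ⁻¹`),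
  transports `‖U‖, ‖U⁻¹‖ ≦ ρ` and `ηα₁ℓ⁻¹ ≦ 1/4` (`norm_diffLetter_prodCfg_sub_le`), hence letters of the calculus:
  ★ `hasMajorant_diffLetter_prodCfg_sub` — `conj b (∇♯_{U′U,k} − ∇♯_{U,k}) ≺ 4ρ²M₂(Σ‖b_i‖)e^{δd₀}·α₁·ℓ⁻¹·e^{−δd}`.
* §3 ★ `hasMajorant_diffLetter_prodCfg_mul` (LEFT): from `∇♯_{U,k}·Gp ≺ B·ℓ·e^{−δd}` and `Gp ≺ B·ℓ²·e^{−δd}`, the scale transfer of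
  `ℓ²` at exponent `α` (constant `Λ`) and (2.61) at `β`: `∇♯_{U′U,k}·Gp ≺ (1 + 4ρ²M₂(Σ‖b_i‖)e^{δd₀}·α₁·Λ·c₁(β))·B·ℓ·e^{−ρd}`,
  `ρ + (α+β)δ₀ ≦ δ`;  ★ `hasMajorant_mul_diffLetter_prodCfg` (RIGHT): the same for `Gp·∇♯_{U′U,k}` with the transfer of `ℓ⁻¹`
  (this transfer IS the level-gap bookkeeping `L^{j(y)−j(y′)} ≲ e^{αδ₀d(y,y′)}` of the right conversion).
* §4 ★ `hasMajorant_V1pOp_mul` — (3.63) FOR THE LAPLACIAN PART `V′₁(A)` ALONE: `conj b V′₁(A) * Gp ≺ κ₃₈₅(B, c_V, 0, 0, Λ, c₁)·α₁·e^{−ρd}`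
  from `Gp`, ALL `∇♯_k·Gp` (`k ∈ κ ⊕ κ` — the augmented left entries), the (3.37) letters, `B9Ineq363Vprime.ineq363_op_sum` BY NAME
  with `hVg := B9Eq352GradLetters.conj_V1pOp_eq_gradForm`; ★ `hasMajorant_lap_prodCfg_mul` (LAPLACIAN): for ANY ℝ-linear `L_U, L_W`
  with `L_W = L_U − V′₁(A)` ((3.53); at NODE 00 `B9Eq360DeltaPrimeAY.lapSL_mulY_fluct` scaled by `η⁻²`) and `L_U·Gp ≺ B·e^{−δd}`:
  `L_W·Gp ≺ (B + κ·α₁)·e^{−ρd}`.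

HONEST SCOPE.  Finite-dimensional operator algebra over r06's concrete letters; the inputs are HYPOTHESES in the shapes the
Sect.-B frames produce (block majorants of [4] (2.51)) and the outputs are block majorants; no statement of Theorem 3.1 is
asserted; (2.61) and the scale transfers enter as hypotheses (`Ineq261`, `ScaleTransfer`), exactly as in `B9Ineq363Vprime`.
Count-neutral bookkeeping of print's «of course with different constants»; NOT a node discharge, NOT summit progress; one finite
lattice programme at fixed ε — nothing continuum, nothing about OS or the mass gap.  Cell `pub-ymgap` (HUMAN RULING D-0062), Track A
node N06 [B9], N06-ASSIGNMENT row 13 (`hB`), seat `pub-ymgap-dag-n06-c` (g8), 2026-08-27; consumer: the `hconv` hypothesis of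
`B9SectBGpTransferOutY.thms_pullK_prod_of_KSC` (p578467).

RELATED IN THE TREE, NOT DUPLICATED: `B9Eq370Expansion` (pv27: (3.70)/(3.74) pointwise, `norm_covD(star)_prodCfg_sub_le` — consumed
BY NAME), `B9Eq352ScalarFluct` (`eq353`, `exp_two_mul_le_two`), `B9Eq352GradLetters` (`V1pOp`, `hasMajorant_V0op`,
`hasMajorant_coefLetter`, `conj_V1pOp_eq_gradForm`), `B9Eq352DivFormLetters` (`conj`, `diffLetter`-family, `hasMajorant_conj_of_local`),
`B9Ineq363Vprime` (`ineq363_op_sum` — (3.63) for the FULL `V′(A)`; here only its Laplacian part is needed and `Gp` is arbitrary),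
`B9Ineq366CPrime` (`hasMajorant_comp_decay`, `hasMajorant_rate_mono`), `B9SectBGpTransferOutY` §3 (g7: the left letter pointwise
on NODE 00's chart, `cdS_mulY_apply` — the special case `T = shiftY` of §2 here).
-/

noncomputable section

namespace Literature.MathematicalPhysics.QuantumFieldTheory.Balaban1983to89.B9Eq370LetterConversion

open NormedSpace Complex
open Literature.MathematicalPhysics.QuantumFieldTheory.Balaban1983to89
open Literature.MathematicalPhysics.QuantumFieldTheory.Balaban1983to89.B6RandomWalk (HasMajorant hasMajorant_mono
  hasMajorant_add Triangle254 Ineq261)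
open Literature.MathematicalPhysics.QuantumFieldTheory.Balaban1983to89.B9Thm34Ext (toB6)
open Literature.MathematicalPhysics.QuantumFieldTheory.Balaban1983to89.B9Ineq347 (ScaleTransfer)
open Literature.MathematicalPhysics.QuantumFieldTheory.Balaban1983to89.B9Eq39Adjoint (R covD covDstar fluct prodCfg)
open Literature.MathematicalPhysics.QuantumFieldTheory.Balaban1983to89.B9Eq370Expansion (covD_prodCfg covDstar_prodCfg
  norm_covD_prodCfg_sub_le norm_covDstar_prodCfg_sub_le)
open Literature.MathematicalPhysics.QuantumFieldTheory.Balaban1983to89.B9Eq371Composition (norm_R_le_sq)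
open Literature.MathematicalPhysics.QuantumFieldTheory.Balaban1983to89.B9Eq352ScalarFluct (exp_two_mul_le_two)
open Literature.MathematicalPhysics.QuantumFieldTheory.Balaban1983to89.B9Eq352DivForm (tauB)
open Literature.MathematicalPhysics.QuantumFieldTheory.Balaban1983to89.B9Eq352DivFormLetters (conj conj_mul conj_sub conj_neg
  gradLetterF gradLetterB gradLetterF_apply gradLetterB_apply hasMajorant_conj_of_local)
open Literature.MathematicalPhysics.QuantumFieldTheory.Balaban1983to89.B9Eq352GradLetters (V0op V1pOp coefLetter diffLetter
  diffLetter_inl diffLetter_inr hasMajorant_coefLetter hasMajorant_V0op conj_V1pOp_eq_gradForm)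
open Literature.MathematicalPhysics.QuantumFieldTheory.Balaban1983to89.B9Ineq385VG (kappa385 kappa385_nonneg)
open Literature.MathematicalPhysics.QuantumFieldTheory.Balaban1983to89.B9Ineq363Vprime (ineq363_op_sum)
open Literature.MathematicalPhysics.QuantumFieldTheory.Balaban1983to89.B9Ineq366CPrime (hasMajorant_comp_decay
  hasMajorant_rate_mono)
open Literature.MathematicalPhysics.QuantumFieldTheory.Balaban1983to89.B9Ineq368PPrime (hasMajorant_neg)

/-! ## §1  The smallness arithmetic of `R(U′) = exp ηiad_A` -/

section Arith

/-- `e^x − 1 ≦ x·e^x` (from `1 − x ≦ e^{−x}`). [folklore] -/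
private theorem exp_sub_one_le_mul_exp (x : ℝ) : Real.exp x - 1 ≤ x * Real.exp x := by
  have h := Real.add_one_le_exp (-x)
  have hpos := Real.exp_pos x
  have h1 : (-x + 1) * Real.exp x ≤ Real.exp (-x) * Real.exp x := mul_le_mul_of_nonneg_right h hpos.le
  rw [← Real.exp_add, neg_add_cancel, Real.exp_zero] at h1
  nlinarith

/-- **«R(U′) = exp ηiad_A = 1 + ⋯» in size**: `e^{2s} − 1 ≦ 4s` for `0 ≦ s ≦ 1/4` (`e^{1/2} ≦ 2`, r06's `exp_two_mul_le_two`).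
[cite: Balaban1985BackgroundPropagators, p.405 («R(U′) = exp ηiad_A = 1 + ηiad_A + ⋯»), (3.37) p.396] -/
theorem exp_two_mul_sub_one_le {s : ℝ} (hs : 0 ≤ s) (hs4 : s ≤ 1 / 4) : Real.exp (2 * s) - 1 ≤ 4 * s := by
  have h1 := exp_sub_one_le_mul_exp (2 * s)
  have h2 := exp_two_mul_le_two hs4
  nlinarith

end Arith

/-! ## §2  The transport-defect letters `∇♯_{U′U,k} − ∇♯_{U,k}`, pointwise and as letters of the calculus -/

section Defect

variable {𝔸 : Type*} [NormedRing 𝔸] [NormedAlgebra ℂ 𝔸] [CompleteSpace 𝔸] {ι : Type} [Fintype ι]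
variable (b : Module.Basis ι ℝ 𝔸) {S : Type} {κ : Type}
variable (T : κ → Equiv.Perm S) (U : κ → S → 𝔸ˣ)

/-- **(3.70) for the forward letter**: `(∇_{U′U,μ}λ − ∇_{U,μ}λ)(x) = c·((R(U′_μ(x)) − 1)R(U_μ(x))λ(x+e_μ))`, `c = η⁻¹`.
[cite: Balaban1985BackgroundPropagators, (3.70) p.404] -/
theorem diffLetter_prodCfg_sub_apply_inl (η : ℝ) (c : ℂ) (A : κ → S → 𝔸) (μ : κ) (lam : S → 𝔸) (x : S) :
    (diffLetter T (prodCfg U η A) c (Sum.inl μ) - diffLetter T U c (Sum.inl μ)) lam x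
      = c • (R (fluct η A μ x) (R (U μ x) (lam (T μ x))) - R (U μ x) (lam (T μ x))) := by
  rw [LinearMap.sub_apply, Pi.sub_apply, diffLetter_inl, diffLetter_inl, gradLetterF_apply, gradLetterF_apply, covD_prodCfg,
    ← smul_sub, add_sub_cancel_left]

/-- **(3.74) for the backward letter**: `(∇*-letter_{U′U,μ}λ − ∇*-letter_{U,μ}λ)(x) = −c·(D*_{U′U,μ}λ − D*_{U,μ}λ)(x)` (the letter is `−c·D*`).
[cite: Balaban1985BackgroundPropagators, (3.74) p.405, (3.8) p.392] -/
theorem diffLetter_prodCfg_sub_apply_inr (η : ℝ) (c : ℂ) (A : κ → S → 𝔸) (μ : κ) (lam : S → 𝔸) (x : S) :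
    (diffLetter T (prodCfg U η A) c (Sum.inr μ) - diffLetter T U c (Sum.inr μ)) lam x
      = -(c • (covDstar T (prodCfg U η A) μ lam x - covDstar T U μ lam x)) := by
  rw [LinearMap.sub_apply, Pi.sub_apply, diffLetter_inr, diffLetter_inr, LinearMap.neg_apply, LinearMap.neg_apply, Pi.neg_apply,
    Pi.neg_apply, gradLetterB_apply, gradLetterB_apply, smul_sub]
  abel

omit [CompleteSpace 𝔸] in
/-- `‖η⁻¹·X‖ = η⁻¹‖X‖` for `η > 0`. [folklore] -/
private theorem norm_inv_smul {η : ℝ} (hη : 0 < η) (X : 𝔸) : ‖((η : ℂ))⁻¹ • X‖ = η⁻¹ * ‖X‖ := by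
  rw [norm_smul, norm_inv, Complex.norm_real, Real.norm_eq_abs, abs_of_pos hη]

/-- **THE TRANSPORT DEFECT, POINTWISE** (both orientations): under (3.37) read blockwise (`‖A_μ(x)‖ ≦ α₁ℓ⁻¹`, `‖τ*_μA_μ(x)‖ ≦ α₁ℓ⁻¹`,
`ℓ = g.len (blk x)`), transports `‖U‖, ‖U⁻¹‖ ≦ ρ` and the smallness `ηα₁ℓ⁻¹ ≦ 1/4` («for α₁ sufficiently small»):
`‖((∇♯_{U′U,k} − ∇♯_{U,k})λ)(x)‖ ≦ 4ρ²·α₁ℓ⁻¹·‖λ(x′)‖`, `x′ = x + e_μ` (forward) resp. `x − e_μ` (backward) — the factor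
`η⁻¹(e^{2η‖A‖} − 1) ≦ 4‖A‖` of «R(U′) = exp ηiad_A». [cite: Balaban1985BackgroundPropagators, (3.70) p.404, (3.74) p.405, (3.37) p.396] -/
theorem norm_diffLetter_prodCfg_sub_le {g : B9.Geometry} (blk : S → g.Site) {η : ℝ} (hη : 0 < η) (A : κ → S → 𝔸)
    {ρ α₁ : ℝ} (hα₁ : 0 ≤ α₁) (hlen : ∀ y : g.Site, 0 < g.len y) (hsmall : ∀ y : g.Site, η * (α₁ * (g.len y)⁻¹) ≤ 1 / 4)
    (hA : ∀ μ x, ‖A μ x‖ ≤ α₁ * (g.len (blk x))⁻¹ ∧ ‖tauB T U μ (A μ) x‖ ≤ α₁ * (g.len (blk x))⁻¹)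
    (hρ : ∀ μ x, ‖((U μ x : 𝔸ˣ) : 𝔸)‖ ≤ ρ ∧ ‖(((U μ x)⁻¹ : 𝔸ˣ) : 𝔸)‖ ≤ ρ) (k : κ ⊕ κ) (lam : S → 𝔸) (x : S) :
    ‖(diffLetter T (prodCfg U η A) (((η : ℂ))⁻¹) k - diffLetter T U (((η : ℂ))⁻¹) k) lam x‖
      ≤ 4 * ρ ^ 2 * (α₁ * (g.len (blk x))⁻¹) *
        ‖lam (match k with | Sum.inl μ => T μ x | Sum.inr μ => (T μ).symm x)‖ := by
  have hw : 0 ≤ α₁ * (g.len (blk x))⁻¹ := mul_nonneg hα₁ (inv_nonneg.mpr (hlen _).le)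
  -- the smallness factor: for `‖a‖ ≤ α₁ℓ⁻¹`, `η⁻¹(e^{2η‖a‖} − 1) ≤ 4α₁ℓ⁻¹`
  have hfac : ∀ a : 𝔸, ‖a‖ ≤ α₁ * (g.len (blk x))⁻¹ → η⁻¹ * (Real.exp (2 * (η * ‖a‖)) - 1) ≤ 4 * (α₁ * (g.len (blk x))⁻¹) := by
    intro a ha
    have hs0 : 0 ≤ η * ‖a‖ := mul_nonneg hη.le (norm_nonneg _)
    have hs4 : η * ‖a‖ ≤ 1 / 4 := (mul_le_mul_of_nonneg_left ha hη.le).trans (hsmall _)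
    have h1 := exp_two_mul_sub_one_le hs0 hs4
    rw [inv_mul_le_iff₀ hη]
    calc Real.exp (2 * (η * ‖a‖)) - 1 ≤ 4 * (η * ‖a‖) := h1
      _ ≤ 4 * (η * (α₁ * (g.len (blk x))⁻¹)) := by gcongr
      _ = η * (4 * (α₁ * (g.len (blk x))⁻¹)) := by ring
  cases k with
  | inl μ =>
    rw [diffLetter_prodCfg_sub_apply_inl, norm_inv_smul hη]
    have h1 := norm_covD_prodCfg_sub_le T U hη.le A μ lam x
    rw [covD_prodCfg, add_sub_cancel_left] at h1
    have h2 : ‖R (U μ x) (lam (T μ x))‖ ≤ ρ ^ 2 * ‖lam (T μ x)‖ := norm_R_le_sq (U μ x) (hρ μ x).1 (hρ μ x).2 _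
    have he : 0 ≤ Real.exp (2 * (η * ‖A μ x‖)) - 1 := by
      have := Real.one_le_exp (show 0 ≤ 2 * (η * ‖A μ x‖) by positivity); linarith
    calc η⁻¹ * ‖R (fluct η A μ x) (R (U μ x) (lam (T μ x))) - R (U μ x) (lam (T μ x))‖
        ≤ η⁻¹ * ((Real.exp (2 * (η * ‖A μ x‖)) - 1) * (ρ ^ 2 * ‖lam (T μ x)‖)) :=
          mul_le_mul_of_nonneg_left (h1.trans (mul_le_mul_of_nonneg_left h2 he)) (inv_nonneg.mpr hη.le)
      _ = (η⁻¹ * (Real.exp (2 * (η * ‖A μ x‖)) - 1)) * (ρ ^ 2 * ‖lam (T μ x)‖) := by ring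
      _ ≤ (4 * (α₁ * (g.len (blk x))⁻¹)) * (ρ ^ 2 * ‖lam (T μ x)‖) :=
          mul_le_mul_of_nonneg_right (hfac _ (hA μ x).1) (by positivity)
      _ = _ := by simp only; ring
  | inr μ =>
    rw [diffLetter_prodCfg_sub_apply_inr, norm_neg, norm_inv_smul hη]
    have h1 := norm_covDstar_prodCfg_sub_le T U hη.le A μ lam x
    have hV : ‖(((U μ ((T μ).symm x))⁻¹ : 𝔸ˣ) : 𝔸)‖ ≤ ρ ∧ ‖((((U μ ((T μ).symm x))⁻¹)⁻¹ : 𝔸ˣ) : 𝔸)‖ ≤ ρ := by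
      rw [inv_inv]; exact ⟨(hρ μ _).2, (hρ μ _).1⟩
    have h2 : ‖R (U μ ((T μ).symm x))⁻¹ (lam ((T μ).symm x))‖ ≤ ρ ^ 2 * ‖lam ((T μ).symm x)‖ := norm_R_le_sq _ hV.1 hV.2 _
    have ha : ‖R (U μ ((T μ).symm x))⁻¹ (A μ ((T μ).symm x))‖ ≤ α₁ * (g.len (blk x))⁻¹ := (hA μ x).2
    have he : 0 ≤ Real.exp (2 * (η * ‖R (U μ ((T μ).symm x))⁻¹ (A μ ((T μ).symm x))‖)) - 1 := by
      have := Real.one_le_exp (show 0 ≤ 2 * (η * ‖R (U μ ((T μ).symm x))⁻¹ (A μ ((T μ).symm x))‖) by positivity); linarith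
    calc η⁻¹ * ‖covDstar T (prodCfg U η A) μ lam x - covDstar T U μ lam x‖
        ≤ η⁻¹ * ((Real.exp (2 * (η * ‖R (U μ ((T μ).symm x))⁻¹ (A μ ((T μ).symm x))‖)) - 1) * (ρ ^ 2 * ‖lam ((T μ).symm x)‖)) :=
          mul_le_mul_of_nonneg_left (h1.trans (mul_le_mul_of_nonneg_left h2 he)) (inv_nonneg.mpr hη.le)
      _ = (η⁻¹ * (Real.exp (2 * (η * ‖R (U μ ((T μ).symm x))⁻¹ (A μ ((T μ).symm x))‖)) - 1)) * (ρ ^ 2 * ‖lam ((T μ).symm x)‖) := by ring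
      _ ≤ (4 * (α₁ * (g.len (blk x))⁻¹)) * (ρ ^ 2 * ‖lam ((T μ).symm x)‖) :=
          mul_le_mul_of_nonneg_right (hfac _ ha) (by positivity)
      _ = _ := by simp only; ring

variable {g : B9.Geometry} [Fintype g.Site] {Rr : ℝ} {H : Prop}

/-- ★ **THE TRANSPORT-DEFECT LETTERS ARE LETTERS OF THE CALCULUS**: under (3.37) blockwise, transports `≦ ρ`, `ηα₁ℓ⁻¹ ≦ 1/4`, the star
of every `x` in blocks at `d`-distance `≦ d₀` and the coordinate constant `M₂`:
`conj b (∇♯_{U′U,k} − ∇♯_{U,k}) ≺ (4ρ²α₁ℓ(y)⁻¹)·M₂(Σ_i‖b_i‖)·e^{δd₀}·e^{−δd(y,y′)}` for every `k ∈ κ ⊕ κ` and every `δ ≧ 0` — the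
size `O(1)·α₁(Lʲη)⁻¹` of the first-order defect of (3.70)/(3.74) in the shape [4] (2.51).
[cite: Balaban1985BackgroundPropagators, (3.70) p.404, (3.74) p.405, (3.37) p.396; Balaban1984PropagatorsII, (2.51) p.232] -/
theorem hasMajorant_diffLetter_prodCfg_sub (blk : S → g.Site) {η : ℝ} (hη : 0 < η) (A : κ → S → 𝔸) (ρ d₀ δ M₂ α₁ : ℝ)
    (hα₁ : 0 ≤ α₁) (hδ : 0 ≤ δ) (hM₂ : 0 ≤ M₂) (hrepr : ∀ (v : 𝔸) (i : ι), |b.repr v i| ≤ M₂ * ‖v‖)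
    (hlen : ∀ y : g.Site, 0 < g.len y) (hsmall : ∀ y : g.Site, η * (α₁ * (g.len y)⁻¹) ≤ 1 / 4)
    (hA : ∀ μ x, ‖A μ x‖ ≤ α₁ * (g.len (blk x))⁻¹ ∧ ‖tauB T U μ (A μ) x‖ ≤ α₁ * (g.len (blk x))⁻¹)
    (hρ : ∀ μ x, ‖((U μ x : 𝔸ˣ) : 𝔸)‖ ≤ ρ ∧ ‖(((U μ x)⁻¹ : 𝔸ˣ) : 𝔸)‖ ≤ ρ)
    (hd₀ : ∀ μ x, g.dist (blk x) (blk (T μ x)) ≤ d₀ ∧ g.dist (blk x) (blk ((T μ).symm x)) ≤ d₀) (k : κ ⊕ κ) :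
    HasMajorant (g := toB6 g Rr H) (fun p : S × ι => blk p.1)
      (conj b (diffLetter T (prodCfg U η A) (((η : ℂ))⁻¹) k - diffLetter T U (((η : ℂ))⁻¹) k))
      (fun y y' => (4 * ρ ^ 2 * M₂ * (∑ i, ‖b i‖) * Real.exp (δ * d₀)) * α₁ * (g.len y)⁻¹ * Real.exp (-(δ * g.dist y y'))) := by
  have hc0 : ∀ y : g.Site, 0 ≤ 4 * ρ ^ 2 * (α₁ * (g.len y)⁻¹) := fun y =>
    mul_nonneg (by positivity) (mul_nonneg hα₁ (inv_nonneg.mpr (hlen y).le))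
  -- the stencil: the one neighbour the defect reads
  let near : S → S → Prop := fun x x' => x' = (match k with | Sum.inl μ => T μ x | Sum.inr μ => (T μ).symm x)
  have hnear : ∀ x x', near x x' → g.dist (blk x) (blk x') ≤ d₀ := by
    intro x x' hx'
    cases k with
    | inl μ => simp only [near] at hx'; rw [hx']; exact (hd₀ μ x).1
    | inr μ => simp only [near] at hx'; rw [hx']; exact (hd₀ μ x).2
  refine hasMajorant_mono (g := toB6 g Rr H) _
    (hasMajorant_conj_of_local (Rr := Rr) (H := H) b blk near (fun y => 4 * ρ ^ 2 * (α₁ * (g.len y)⁻¹)) d₀ δ M₂ hc0 hδ hM₂ hrepr hnear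
      _ ?_) fun y y' => le_of_eq (by ring)
  intro f x B hB
  have hB' : ‖f (match k with | Sum.inl μ => T μ x | Sum.inr μ => (T μ).symm x)‖ ≤ B := hB _ rfl
  have h0 : 0 ≤ 4 * ρ ^ 2 * (α₁ * (g.len (blk x))⁻¹) := hc0 _
  exact (norm_diffLetter_prodCfg_sub_le T U blk hη A hα₁ hlen hsmall hA hρ k f x).trans (mul_le_mul_of_nonneg_left hB' h0)

end Defect

/-! ## §3  ★ The LEFT and RIGHT conversions composed with the (3.42) entries of `Gp` -/

section LeftRight

variable {𝔸 : Type*} [NormedRing 𝔸] [NormedAlgebra ℂ 𝔸] [CompleteSpace 𝔸] {ι : Type} [Fintype ι]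
variable (b : Module.Basis ι ℝ 𝔸) {S : Type} {κ : Type}
variable (T : κ → Equiv.Perm S) (U : κ → S → 𝔸ˣ)
variable {g : B9.Geometry} [Fintype g.Site] {Rr : ℝ} {H : Prop}

/-- ★ **THE LEFT CONVERSION `∇♯_{U,k}·Gp ↦ ∇♯_{U′U,k}·Gp`** (p. 403 l.1–9 with (3.70)): if `∇♯_{U,k}·Gp ≺ B·ℓ·e^{−δd}` (the second
(3.42) entry with the letter at the base) and `Gp ≺ B·ℓ²·e^{−δd}` (the first entry), then under (3.37) blockwise, transports `≦ ρu`,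
`ηα₁ℓ⁻¹ ≦ 1/4`, the stencil geometry, the scale transfer of `ℓ²` at exponent `α` (constant `Λ`) and (2.61) at `β`:
`∇♯_{U′U,k}·Gp ≺ (1 + 4ρu²M₂(Σ‖b_i‖)e^{δd₀}·α₁·Λ·c₁(β))·B·ℓ·e^{−ρd}` for `ρ ≧ 0`, `ρ + (α+β)δ₀ ≦ δ` — «of course with different
constants, although changes are small» (the change is `O(α₁)`).
[cite: Balaban1985BackgroundPropagators, p.403 l.1–9, (3.70) p.404, (3.42) p.397; Balaban1984PropagatorsII, (2.52)–(2.55) p.232, Lemma 2.1 p.234] -/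
theorem hasMajorant_diffLetter_prodCfg_mul (blk : S → g.Site) (d : ℕ) {η : ℝ} (hη : 0 < η) (A : κ → S → 𝔸)
    (ρu d₀ M₂ α₁ δ₀ δ α β ρ Λ B : ℝ)
    (hα₁ : 0 ≤ α₁) (hδ : 0 ≤ δ) (hM₂ : 0 ≤ M₂) (hB : 0 ≤ B) (hΛ : 0 ≤ Λ) (hρ : 0 ≤ ρ) (hr : ρ + (α + β) * δ₀ ≤ δ) (hρδ : ρ ≤ δ)
    (hrepr : ∀ (v : 𝔸) (i : ι), |b.repr v i| ≤ M₂ * ‖v‖)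
    (hdnn : ∀ a a' : g.Site, 0 ≤ g.dist a a') (htri : Triangle254 (toB6 g Rr H)) (hlen : ∀ y : g.Site, 0 < g.len y)
    (h261 : Ineq261 d (toB6 g Rr H) δ₀ β) (hT2 : ScaleTransfer g δ₀ α Λ (fun a => g.len a ^ 2))
    (hsmall : ∀ y : g.Site, η * (α₁ * (g.len y)⁻¹) ≤ 1 / 4)
    (hA : ∀ μ x, ‖A μ x‖ ≤ α₁ * (g.len (blk x))⁻¹ ∧ ‖tauB T U μ (A μ) x‖ ≤ α₁ * (g.len (blk x))⁻¹)
    (hρu : ∀ μ x, ‖((U μ x : 𝔸ˣ) : 𝔸)‖ ≤ ρu ∧ ‖(((U μ x)⁻¹ : 𝔸ˣ) : 𝔸)‖ ≤ ρu)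
    (hd₀ : ∀ μ x, g.dist (blk x) (blk (T μ x)) ≤ d₀ ∧ g.dist (blk x) (blk ((T μ).symm x)) ≤ d₀) (k : κ ⊕ κ)
    {Gp : Module.End ℝ (S × ι → ℝ)}
    (hG : HasMajorant (g := toB6 g Rr H) (fun p : S × ι => blk p.1) Gp (fun a a' => B * g.len a ^ 2 * Real.exp (-(δ * g.dist a a'))))
    (hDG : HasMajorant (g := toB6 g Rr H) (fun p : S × ι => blk p.1) (conj b (diffLetter T U (((η : ℂ))⁻¹) k) * Gp)
      (fun a a' => B * g.len a * Real.exp (-(δ * g.dist a a')))) :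
    HasMajorant (g := toB6 g Rr H) (fun p : S × ι => blk p.1) (conj b (diffLetter T (prodCfg U η A) (((η : ℂ))⁻¹) k) * Gp)
      (fun a a' => ((1 + (4 * ρu ^ 2 * M₂ * (∑ i, ‖b i‖) * Real.exp (δ * d₀)) * α₁ * Λ * B6.c1 d δ₀ β) * B) * g.len a *
        Real.exp (-(ρ * g.dist a a'))) := by
  set cD : ℝ := 4 * ρu ^ 2 * M₂ * (∑ i, ‖b i‖) * Real.exp (δ * d₀) with hcD
  have hSb : 0 ≤ ∑ i, ‖b i‖ := Finset.sum_nonneg fun i _ => norm_nonneg _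
  have hcD0 : 0 ≤ cD := by positivity
  have hw1 : ∀ a : g.Site, 0 ≤ (g.len a)⁻¹ := fun a => inv_nonneg.mpr (hlen a).le
  have hw2 : ∀ a : g.Site, 0 ≤ g.len a ^ 2 := fun a => sq_nonneg _
  -- the defect letter (rate δ) composed with `Gp` (rate ρ): weight ℓ⁻¹·ℓ² = ℓ
  have hdef := hasMajorant_diffLetter_prodCfg_sub b T U (Rr := Rr) (H := H) blk hη A ρu d₀ δ M₂ α₁ hα₁ hδ hM₂ hrepr hlen hsmall hA hρu hd₀ k
  have hGρ : HasMajorant (g := toB6 g Rr H) (fun p : S × ι => blk p.1) Gp (fun a a' => B * g.len a ^ 2 * Real.exp (-(ρ * g.dist a a'))) :=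
    hasMajorant_rate_mono (R := Rr) (H := H) _ B (fun a => g.len a ^ 2) hB hw2 hρδ hdnn hG
  have hcomp := hasMajorant_comp_decay (R := Rr) (H := H) (fun p : S × ι => blk p.1) d δ₀ α β ρ δ Λ (cD * α₁) B
    (fun a => (g.len a)⁻¹) (fun a => g.len a ^ 2) hw1 hw2 hΛ (mul_nonneg hcD0 hα₁) hB hρ hr hdnn htri hT2 h261
    (hasMajorant_mono (g := toB6 g Rr H) _ hdef fun a a' => le_of_eq (by ring)) hGρ
  -- the base letter's entry at the smaller rate
  have hDGρ : HasMajorant (g := toB6 g Rr H) (fun p : S × ι => blk p.1) (conj b (diffLetter T U (((η : ℂ))⁻¹) k) * Gp)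
      (fun a a' => B * g.len a * Real.exp (-(ρ * g.dist a a'))) :=
    hasMajorant_rate_mono (R := Rr) (H := H) _ B (fun a => g.len a) hB (fun a => (hlen a).le) hρδ hdnn hDG
  -- `∇♯_{U′U,k}·Gp = ∇♯_{U,k}·Gp + (∇♯_{U′U,k} − ∇♯_{U,k})·Gp`
  have hsplit : conj b (diffLetter T (prodCfg U η A) (((η : ℂ))⁻¹) k) * Gp
      = conj b (diffLetter T U (((η : ℂ))⁻¹) k) * Gp
        + conj b (diffLetter T (prodCfg U η A) (((η : ℂ))⁻¹) k - diffLetter T U (((η : ℂ))⁻¹) k) * Gp := by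
    rw [conj_sub, sub_mul, add_sub_cancel]
  rw [hsplit]
  refine hasMajorant_mono (g := toB6 g Rr H) _ (hasMajorant_add (g := toB6 g Rr H) _ hDGρ hcomp) fun a a' => le_of_eq ?_
  have hl : (g.len a)⁻¹ * g.len a ^ 2 = g.len a := by field_simp [(hlen a).ne']
  calc B * g.len a * Real.exp (-(ρ * g.dist a a'))
        + cD * α₁ * B * Λ * B6.c1 d δ₀ β * ((g.len a)⁻¹ * g.len a ^ 2) * Real.exp (-(ρ * g.dist a a'))
      = B * g.len a * Real.exp (-(ρ * g.dist a a')) + cD * α₁ * B * Λ * B6.c1 d δ₀ β * g.len a * Real.exp (-(ρ * g.dist a a')) := by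
        rw [hl]
    _ = _ := by ring

/-- ★ **THE RIGHT CONVERSION `Gp·∇♯_{U,k} ↦ Gp·∇♯_{U′U,k}`** (p. 403 l.1–9 with (3.74)): if `Gp·∇♯_{U,k} ≺ B·ℓ·e^{−δd}` (the third
(3.42) entry with the letter at the base) and `Gp ≺ B·ℓ²·e^{−δd}`, then under (3.37) blockwise, transports `≦ ρu`, `ηα₁ℓ⁻¹ ≦ 1/4`,
the stencil geometry, the scale transfer of `ℓ⁻¹` at exponent `α` (constant `Λ` — the INPUT-block defect size `α₁(L^{j′}η)⁻¹`
transferred to the OUTPUT block, i.e. the level-gap bookkeeping `L^{j−j′} ≲ e^{αδ₀d}`) and (2.61) at `β`: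
`Gp·∇♯_{U′U,k} ≺ (1 + 4ρu²M₂(Σ‖b_i‖)e^{δd₀}·α₁·Λ·c₁(β))·B·ℓ·e^{−ρd}` for `ρ ≧ 0`, `ρ + (α+β)δ₀ ≦ δ`.
[cite: Balaban1985BackgroundPropagators, p.403 l.1–9, (3.74) p.405, (3.42) p.397; Balaban1984PropagatorsII, (2.52)–(2.55) p.232, Lemma 2.1 p.234] -/
theorem hasMajorant_mul_diffLetter_prodCfg (blk : S → g.Site) (d : ℕ) {η : ℝ} (hη : 0 < η) (A : κ → S → 𝔸)
    (ρu d₀ M₂ α₁ δ₀ δ α β ρ Λ B : ℝ)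
    (hα₁ : 0 ≤ α₁) (hM₂ : 0 ≤ M₂) (hB : 0 ≤ B) (hΛ : 0 ≤ Λ) (hρ : 0 ≤ ρ) (hr : ρ + (α + β) * δ₀ ≤ δ) (hρδ : ρ ≤ δ)
    (hrepr : ∀ (v : 𝔸) (i : ι), |b.repr v i| ≤ M₂ * ‖v‖)
    (hdnn : ∀ a a' : g.Site, 0 ≤ g.dist a a') (htri : Triangle254 (toB6 g Rr H)) (hlen : ∀ y : g.Site, 0 < g.len y)
    (h261 : Ineq261 d (toB6 g Rr H) δ₀ β) (hTi : ScaleTransfer g δ₀ α Λ (fun a => (g.len a)⁻¹))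
    (hsmall : ∀ y : g.Site, η * (α₁ * (g.len y)⁻¹) ≤ 1 / 4)
    (hA : ∀ μ x, ‖A μ x‖ ≤ α₁ * (g.len (blk x))⁻¹ ∧ ‖tauB T U μ (A μ) x‖ ≤ α₁ * (g.len (blk x))⁻¹)
    (hρu : ∀ μ x, ‖((U μ x : 𝔸ˣ) : 𝔸)‖ ≤ ρu ∧ ‖(((U μ x)⁻¹ : 𝔸ˣ) : 𝔸)‖ ≤ ρu)
    (hd₀ : ∀ μ x, g.dist (blk x) (blk (T μ x)) ≤ d₀ ∧ g.dist (blk x) (blk ((T μ).symm x)) ≤ d₀) (k : κ ⊕ κ)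
    {Gp : Module.End ℝ (S × ι → ℝ)}
    (hG : HasMajorant (g := toB6 g Rr H) (fun p : S × ι => blk p.1) Gp (fun a a' => B * g.len a ^ 2 * Real.exp (-(δ * g.dist a a'))))
    (hGD : HasMajorant (g := toB6 g Rr H) (fun p : S × ι => blk p.1) (Gp * conj b (diffLetter T U (((η : ℂ))⁻¹) k))
      (fun a a' => B * g.len a * Real.exp (-(δ * g.dist a a')))) :
    HasMajorant (g := toB6 g Rr H) (fun p : S × ι => blk p.1) (Gp * conj b (diffLetter T (prodCfg U η A) (((η : ℂ))⁻¹) k))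
      (fun a a' => ((1 + (4 * ρu ^ 2 * M₂ * (∑ i, ‖b i‖) * Real.exp (ρ * d₀)) * α₁ * Λ * B6.c1 d δ₀ β) * B) * g.len a *
        Real.exp (-(ρ * g.dist a a'))) := by
  set cD : ℝ := 4 * ρu ^ 2 * M₂ * (∑ i, ‖b i‖) * Real.exp (ρ * d₀) with hcD
  have hSb : 0 ≤ ∑ i, ‖b i‖ := Finset.sum_nonneg fun i _ => norm_nonneg _
  have hcD0 : 0 ≤ cD := by positivity
  have hw1 : ∀ a : g.Site, 0 ≤ (g.len a)⁻¹ := fun a => inv_nonneg.mpr (hlen a).le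
  have hw2 : ∀ a : g.Site, 0 ≤ g.len a ^ 2 := fun a => sq_nonneg _
  -- the defect letter at rate ρ (any rate is allowed for a local letter), `Gp` at rate δ
  have hdef := hasMajorant_diffLetter_prodCfg_sub b T U (Rr := Rr) (H := H) blk hη A ρu d₀ ρ M₂ α₁ hα₁ hρ hM₂ hrepr hlen hsmall hA hρu hd₀ k
  have hcomp := hasMajorant_comp_decay (R := Rr) (H := H) (fun p : S × ι => blk p.1) d δ₀ α β ρ δ Λ B (cD * α₁)
    (fun a => g.len a ^ 2) (fun a => (g.len a)⁻¹) hw2 hw1 hΛ hB (mul_nonneg hcD0 hα₁) hρ hr hdnn htri hTi h261 hG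
    (hasMajorant_mono (g := toB6 g Rr H) _ hdef fun a a' => le_of_eq (by ring))
  have hGDρ : HasMajorant (g := toB6 g Rr H) (fun p : S × ι => blk p.1) (Gp * conj b (diffLetter T U (((η : ℂ))⁻¹) k))
      (fun a a' => B * g.len a * Real.exp (-(ρ * g.dist a a'))) :=
    hasMajorant_rate_mono (R := Rr) (H := H) _ B (fun a => g.len a) hB (fun a => (hlen a).le) hρδ hdnn hGD
  have hsplit : Gp * conj b (diffLetter T (prodCfg U η A) (((η : ℂ))⁻¹) k)
      = Gp * conj b (diffLetter T U (((η : ℂ))⁻¹) k)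
        + Gp * conj b (diffLetter T (prodCfg U η A) (((η : ℂ))⁻¹) k - diffLetter T U (((η : ℂ))⁻¹) k) := by
    rw [conj_sub, mul_sub, add_sub_cancel]
  rw [hsplit]
  refine hasMajorant_mono (g := toB6 g Rr H) _ (hasMajorant_add (g := toB6 g Rr H) _ hGDρ hcomp) fun a a' => le_of_eq ?_
  have hl : g.len a ^ 2 * (g.len a)⁻¹ = g.len a := by field_simp [(hlen a).ne']
  calc B * g.len a * Real.exp (-(ρ * g.dist a a'))
        + B * (cD * α₁) * Λ * B6.c1 d δ₀ β * (g.len a ^ 2 * (g.len a)⁻¹) * Real.exp (-(ρ * g.dist a a'))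
      = B * g.len a * Real.exp (-(ρ * g.dist a a')) + B * (cD * α₁) * Λ * B6.c1 d δ₀ β * g.len a * Real.exp (-(ρ * g.dist a a')) := by
        rw [hl]
    _ = _ := by ring

end LeftRight

/-! ## §4  ★ (3.63) for the Laplacian part `V′₁(A)` alone and the LAPLACIAN conversion -/

section Laplacian

variable {𝔸 : Type*} [NormedRing 𝔸] [NormedAlgebra ℂ 𝔸] [CompleteSpace 𝔸] {ι : Type} [Fintype ι]
variable (b : Module.Basis ι ℝ 𝔸) {S : Type} {κ : Type} [Fintype κ]
variable (T : κ → Equiv.Perm S) (U : κ → S → 𝔸ˣ)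
variable {g : B9.Geometry} [Fintype g.Site] {Rr : ℝ} {H : Prop}

/-- ★ **(3.63) FOR THE LAPLACIAN PART `V′₁(A)` OF `V′(A)`** ((3.53): `Δ_{U′U} = Δ_U − V′₁(A)`), for an ARBITRARY operator `Gp` with the
(3.42)₁,₂ majorants (`Gp ≺ Bℓ²e^{−δd}`, `∇♯_k·Gp ≺ Bℓe^{−δd}` for ALL `k ∈ κ ⊕ κ`): under (3.37) blockwise for the letters of `V′₁(A)`
as they occur, transports `≦ ρu`, `ηα₁ℓ⁻¹ ≦ 1/4`, the stencil geometry, the scale transfers of `ℓ`, `ℓ²` at `α` and (2.61) at `β`: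
`conj b V′₁(A) * Gp ≺ κ₃₈₅(B, c_V, 0, 0, Λ, c₁(β))·α₁·e^{−ρd}` with `c_V = ((2 + 8ρu²α₁)|κ| + 2|κ|·2)·M₂(Σ‖b_i‖)e^{δd₀}`
(`B9Ineq363Vprime.ineq363_op_sum` with `V := conj b V′₁`, `V0 := conj b V⁰`, `V1 k := conj b V¹_k`, `D k := conj b ∇♯_k`, BY NAME).
[cite: Balaban1985BackgroundPropagators, (3.63) p.402, (3.52)–(3.54) pp.400–401, (3.37) p.396, (3.42) p.397; Balaban1984PropagatorsII, Lemma 2.1 p.234, (2.52)–(2.55) p.232] -/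
theorem hasMajorant_V1pOp_mul (blk : S → g.Site) (d : ℕ) {η : ℝ} (hη : 0 < η) (A : κ → S → 𝔸)
    (ρu d₀ M₂ α₁ δ₀ δ α β ρ Λ B : ℝ)
    (hα₁ : 0 ≤ α₁) (hδ : 0 ≤ δ) (hM₂ : 0 ≤ M₂) (hB : 0 ≤ B) (hΛ : 0 ≤ Λ) (hρ : 0 ≤ ρ) (hα : 0 ≤ α) (hβ : 0 ≤ β) (hδ₀ : 0 ≤ δ₀)
    (hr : ρ + (α + β) * δ₀ ≤ δ)
    (hrepr : ∀ (v : 𝔸) (i : ι), |b.repr v i| ≤ M₂ * ‖v‖)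
    (hdnn : ∀ a a' : g.Site, 0 ≤ g.dist a a') (htri : Triangle254 (toB6 g Rr H)) (hlen : ∀ y : g.Site, 0 < g.len y)
    (h261 : Ineq261 d (toB6 g Rr H) δ₀ β)
    (hT1 : ScaleTransfer g δ₀ α Λ (fun a => g.len a)) (hT2 : ScaleTransfer g δ₀ α Λ (fun a => g.len a ^ 2))
    (hsmall : ∀ y : g.Site, η * (α₁ * (g.len y)⁻¹) ≤ 1 / 4)
    (hA : ∀ μ x, ‖A μ x‖ ≤ α₁ * (g.len (blk x))⁻¹ ∧ ‖tauB T U μ (A μ) x‖ ≤ α₁ * (g.len (blk x))⁻¹)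
    (h337s : ∀ μ x, ‖((η : ℂ)⁻¹) • covDstar T U μ (A μ) x‖ ≤ α₁ * (g.len (blk x) ^ 2)⁻¹)
    (hρu : ∀ μ x, ‖((U μ x : 𝔸ˣ) : 𝔸)‖ ≤ ρu ∧ ‖(((U μ x)⁻¹ : 𝔸ˣ) : 𝔸)‖ ≤ ρu)
    (hd₀ : ∀ μ x, g.dist (blk x) (blk (T μ x)) ≤ d₀ ∧ g.dist (blk x) (blk ((T μ).symm x)) ≤ d₀)
    (hd₀0 : ∀ y : g.Site, g.dist y y ≤ d₀)
    {Gp : Module.End ℝ (S × ι → ℝ)}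
    (hG : HasMajorant (g := toB6 g Rr H) (fun p : S × ι => blk p.1) Gp (fun a a' => B * g.len a ^ 2 * Real.exp (-(δ * g.dist a a'))))
    (hDG : ∀ k : κ ⊕ κ, HasMajorant (g := toB6 g Rr H) (fun p : S × ι => blk p.1) (conj b (diffLetter T U (((η : ℂ))⁻¹) k) * Gp)
      (fun a a' => B * g.len a * Real.exp (-(δ * g.dist a a')))) :
    HasMajorant (g := toB6 g Rr H) (fun p : S × ι => blk p.1) (conj b (V1pOp T U η A) * Gp)
      (fun a a' => kappa385 B ((((2 + 8 * ρu ^ 2 * α₁) * Fintype.card κ + 2 * Fintype.card κ * 2) * M₂ * (∑ i, ‖b i‖) *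
          Real.exp (δ * d₀))) 0 0 Λ (B6.c1 d δ₀ β) * α₁ * Real.exp (-(ρ * g.dist a a'))) := by
  have hSb : 0 ≤ ∑ i, ‖b i‖ := Finset.sum_nonneg fun i _ => norm_nonneg _
  have hE₀ : 0 ≤ Real.exp (δ * d₀) := Real.exp_nonneg _
  set c0 : ℝ := (2 + 8 * ρu ^ 2 * α₁) * Fintype.card κ * M₂ * (∑ i, ‖b i‖) * Real.exp (δ * d₀) with hc0
  set c1 : ℝ := 2 * M₂ * (∑ i, ‖b i‖) * Real.exp (δ * d₀) with hc1
  have hcard : (0 : ℝ) ≤ Fintype.card κ := Nat.cast_nonneg _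
  have hc00 : 0 ≤ c0 := by positivity
  have hc10 : 0 ≤ c1 := by positivity
  have hcV : 0 ≤ ((2 + 8 * ρu ^ 2 * α₁) * Fintype.card κ + 2 * Fintype.card κ * 2) * M₂ * (∑ i, ‖b i‖) * Real.exp (δ * d₀) := by
    positivity
  have h := ineq363_op_sum (R := Rr) (H := H) (fun p : S × ι => blk p.1) d (Finset.univ : Finset (κ ⊕ κ)) δ₀ δ α β ρ Λ B
    (((2 + 8 * ρu ^ 2 * α₁) * Fintype.card κ + 2 * Fintype.card κ * 2) * M₂ * (∑ i, ‖b i‖) * Real.exp (δ * d₀)) α₁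
    (fun _ => c1) hB hcV hα₁ hΛ hρ hα hβ hδ₀ hr (fun _ _ => hc10) ?_ hdnn htri hlen h261 hT1 hT2
    (V := conj b (V1pOp T U η A)) (V0 := conj b (V0op T U η A)) (V1 := fun k => conj b (coefLetter T U A k))
    (D := fun k => conj b (diffLetter T U (((η : ℂ))⁻¹) k)) (conj_V1pOp_eq_gradForm b T U η A)
    (hasMajorant_mono (g := toB6 g Rr H) _
      (hasMajorant_V0op b T U blk hη A ρu d₀ δ M₂ α₁ hα₁ hδ hM₂ hrepr hlen hsmall hA h337s hρu hd₀ hd₀0) fun a a' => ?_)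
    (fun k _ => hasMajorant_mono (g := toB6 g Rr H) _
      (hasMajorant_coefLetter b T U blk A d₀ δ M₂ α₁ hα₁ hδ hM₂ hrepr hlen hA hd₀0 k) fun a a' => le_of_eq (by simp only [hc1]))
    hG (fun k _ => hDG k)
  · exact h
  · rw [Finset.sum_const, Finset.card_univ, Fintype.card_sum, nsmul_eq_mul, Nat.cast_add, hc1]
    nlinarith [hc00, hM₂, hSb, hE₀, hcard]
  · -- `c0 ≤ c_V`: the zeroth-order constant is below the total
    have hw : 0 ≤ α₁ * (g.len a ^ 2)⁻¹ * Real.exp (-(δ * g.dist a a')) :=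
      mul_nonneg (mul_nonneg hα₁ (inv_nonneg.mpr (sq_nonneg _))) (Real.exp_nonneg _)
    have hle : c0 ≤ ((2 + 8 * ρu ^ 2 * α₁) * Fintype.card κ + 2 * Fintype.card κ * 2) * M₂ * (∑ i, ‖b i‖) * Real.exp (δ * d₀) := by
      rw [hc0]; nlinarith [hM₂, hSb, hE₀, hcard]
    calc c0 * α₁ * (g.len a ^ 2)⁻¹ * Real.exp (-(δ * g.dist a a')) = c0 * (α₁ * (g.len a ^ 2)⁻¹ * Real.exp (-(δ * g.dist a a'))) := by ring
      _ ≤ _ * (α₁ * (g.len a ^ 2)⁻¹ * Real.exp (-(δ * g.dist a a'))) := mul_le_mul_of_nonneg_right hle hw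
      _ = _ := by ring

/-- ★ **THE LAPLACIAN CONVERSION `Δ_U·Gp ↦ Δ_{U′U}·Gp`** (p. 403 l.1–9 with (3.53)): for ANY ℝ-linear `L_U`, `L_W` on `S → 𝔸` with
`L_W = L_U − V′₁(A)` (the Laplacian letters in print's units; at NODE 00 `η⁻²Δ_U`, `η⁻²Δ_{U′U}` by `B9Eq360DeltaPrimeAY.lapSL_mulY_fluct`),
if `conj b L_U * Gp ≺ B·e^{−δd}` (the fourth (3.42) entry with the letter at the base) and the hypotheses of `hasMajorant_V1pOp_mul`
hold, then `conj b L_W * Gp ≺ (B + κ₃₈₅(B, c_V, 0, 0, Λ, c₁)·α₁)·e^{−ρd}`.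
[cite: Balaban1985BackgroundPropagators, p.403 l.1–9, (3.53) p.400, (3.63) p.402, (3.42) p.397; Balaban1984PropagatorsII, Lemma 2.1 p.234] -/
theorem hasMajorant_lap_prodCfg_mul (blk : S → g.Site) (d : ℕ) {η : ℝ} (hη : 0 < η) (A : κ → S → 𝔸)
    (ρu d₀ M₂ α₁ δ₀ δ α β ρ Λ B : ℝ)
    (hα₁ : 0 ≤ α₁) (hδ : 0 ≤ δ) (hM₂ : 0 ≤ M₂) (hB : 0 ≤ B) (hΛ : 0 ≤ Λ) (hρ : 0 ≤ ρ) (hα : 0 ≤ α) (hβ : 0 ≤ β) (hδ₀ : 0 ≤ δ₀)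
    (hr : ρ + (α + β) * δ₀ ≤ δ)
    (hrepr : ∀ (v : 𝔸) (i : ι), |b.repr v i| ≤ M₂ * ‖v‖)
    (hdnn : ∀ a a' : g.Site, 0 ≤ g.dist a a') (htri : Triangle254 (toB6 g Rr H)) (hlen : ∀ y : g.Site, 0 < g.len y)
    (h261 : Ineq261 d (toB6 g Rr H) δ₀ β)
    (hT1 : ScaleTransfer g δ₀ α Λ (fun a => g.len a)) (hT2 : ScaleTransfer g δ₀ α Λ (fun a => g.len a ^ 2))
    (hsmall : ∀ y : g.Site, η * (α₁ * (g.len y)⁻¹) ≤ 1 / 4)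
    (hA : ∀ μ x, ‖A μ x‖ ≤ α₁ * (g.len (blk x))⁻¹ ∧ ‖tauB T U μ (A μ) x‖ ≤ α₁ * (g.len (blk x))⁻¹)
    (h337s : ∀ μ x, ‖((η : ℂ)⁻¹) • covDstar T U μ (A μ) x‖ ≤ α₁ * (g.len (blk x) ^ 2)⁻¹)
    (hρu : ∀ μ x, ‖((U μ x : 𝔸ˣ) : 𝔸)‖ ≤ ρu ∧ ‖(((U μ x)⁻¹ : 𝔸ˣ) : 𝔸)‖ ≤ ρu)
    (hd₀ : ∀ μ x, g.dist (blk x) (blk (T μ x)) ≤ d₀ ∧ g.dist (blk x) (blk ((T μ).symm x)) ≤ d₀)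
    (hd₀0 : ∀ y : g.Site, g.dist y y ≤ d₀)
    {Gp : Module.End ℝ (S × ι → ℝ)} {LU LW : Module.End ℝ (S → 𝔸)} (hL : LW = LU - V1pOp T U η A)
    (hG : HasMajorant (g := toB6 g Rr H) (fun p : S × ι => blk p.1) Gp (fun a a' => B * g.len a ^ 2 * Real.exp (-(δ * g.dist a a'))))
    (hDG : ∀ k : κ ⊕ κ, HasMajorant (g := toB6 g Rr H) (fun p : S × ι => blk p.1) (conj b (diffLetter T U (((η : ℂ))⁻¹) k) * Gp)
      (fun a a' => B * g.len a * Real.exp (-(δ * g.dist a a'))))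
    (hLG : HasMajorant (g := toB6 g Rr H) (fun p : S × ι => blk p.1) (conj b LU * Gp) (fun a a' => B * 1 * Real.exp (-(δ * g.dist a a')))) :
    HasMajorant (g := toB6 g Rr H) (fun p : S × ι => blk p.1) (conj b LW * Gp)
      (fun a a' => (B + kappa385 B ((((2 + 8 * ρu ^ 2 * α₁) * Fintype.card κ + 2 * Fintype.card κ * 2) * M₂ * (∑ i, ‖b i‖) *
          Real.exp (δ * d₀))) 0 0 Λ (B6.c1 d δ₀ β) * α₁) * 1 * Real.exp (-(ρ * g.dist a a'))) := by
  have hV := hasMajorant_V1pOp_mul b T U (Rr := Rr) (H := H) blk d hη A ρu d₀ M₂ α₁ δ₀ δ α β ρ Λ B hα₁ hδ hM₂ hB hΛ hρ hα hβ hδ₀ hr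
    hrepr hdnn htri hlen h261 hT1 hT2 hsmall hA h337s hρu hd₀ hd₀0 hG hDG
  have hρδ : ρ ≤ δ := by nlinarith [mul_nonneg (add_nonneg hα hβ) hδ₀]
  have hLGρ : HasMajorant (g := toB6 g Rr H) (fun p : S × ι => blk p.1) (conj b LU * Gp) (fun a a' => B * 1 * Real.exp (-(ρ * g.dist a a'))) :=
    hasMajorant_rate_mono (R := Rr) (H := H) _ B (fun _ => (1 : ℝ)) hB (fun _ => zero_le_one) hρδ hdnn hLG
  have hsplit : conj b LW * Gp = conj b LU * Gp + -(conj b (V1pOp T U η A) * Gp) := by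
    rw [hL, conj_sub, sub_mul, sub_eq_add_neg]
  rw [hsplit]
  refine hasMajorant_mono (g := toB6 g Rr H) _
    (hasMajorant_add (g := toB6 g Rr H) _ hLGρ (hasMajorant_neg (R := Rr) (H := H) _ hV)) fun a a' => le_of_eq (by ring)

end Laplacian

end Literature.MathematicalPhysics.QuantumFieldTheory.Balaban1983to89.B9Eq370LetterConversion
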